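import Mathlib.Algebra.Ring.GeomSum
import Mathlib.LinearAlgebra.Matrix.Block
import Literature.Computability.AlgebraicComplexity.VPDeterminantalQPProofs
import Literature.Computability.AlgebraicComplexity.CharpolyCoeffPowTrace
import Literature.Computability.AlgebraicComplexity.PowTraceFromDetRepr
import Literature.Computability.AlgebraicComplexity.DeterminantalComplexityProofs

/-!
# Border apolarity, crux `FixedWitnessObstructionQP` — determinantal expressions to read-outs

Route `ValiantsHypothesis/BorderApolarity`, crux item `stmt-ValiantsHypothesis-5778`, line
`toric-face-debordering`, stub `stub_invReprOfDetRepr`: a HOMOGENEOUS polynomial `f` of degree `d`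
over `ℂ` with an affine determinantal expression of size `s` (`HasDetRepr f s`) is a constant
bilinear read-out `vᵀ B⁻¹ w` of an affine matrix `B` with `det B = 1` of size `≤ 2 (s+1)^9`
(`HasInvRepr f (2 * (s + 1) ^ 9)`, the additive size model of `VPDeterminantalQPProofs.lean`).
This is the missing link making affine determinantal complexity polynomially SUB-ADDITIVE along
the line: inverse read-outs add (`HasInvRepr.add` / `HasInvRepr.finset_sum`) and come back to
determinants with one extra row and column (`HasInvRepr.hasDetRepr`).

## Proof

* `f` affine (in particular `f = 0`, `d ≤ 1`): the `2 × 2` matrix of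
  `HasInvRepr.of_totalDegree_le_one` (Bürgisser–Clausen–Shokrollahi 1997, Thm. (21.27), Case 1).
* `2 ≤ d` (so `f ≠ 0`, `d = deg f ≤ s`): the PROVED tree theorem
  `IkenmeyerLandsberg2017_powTrace_of_detRepr_holds` (Ikenmeyer–Landsberg 2017, Thm. 4.1 with
  Rem. 4.5) writes `f = tr(A^d)` for an `N × N` matrix `A` of linear forms,
  `N + 1 ≤ (d+1)((s³-s)/3 + 2)`. The **layered branching program** of `A` (the standard passage
  from iterated matrix multiplication to algebraic branching programs, Ikenmeyer–Landsberg 2017,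
  §2 and Rem. 4.5; Nisan 1991) is the matrix `B = 1 - E` on `Fin (d+1) × Fin N` with
  `E ((ℓ, a), (ℓ+1, b)) = A a b` and all other entries `0`: `E^m` lives on the pairs of layers
  `(ℓ, ℓ+m)` with blocks `A^m` (`layered_pow_apply`), so `E^(d+1) = 0`, `B⁻¹ = Σ_{m ≤ d} E^m`
  (`mul_neg_geom_sum`) and `(B⁻¹) ((0, i), (d, j)) = (A^d) i j`; `B` is block upper triangular for
  the layer map with identity diagonal blocks, so `det B = 1`
  (`Matrix.BlockTriangular.det_fintype`).
  Hence `HasInvRepr ((A^d) i j) ((d+1) N)` (`hasInvRepr_pow_apply`), and summing the diagonal,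
  `HasInvRepr (tr A^d) (N (d+1) N)`; finally `N (d+1) N ≤ (s+1)^4 (s+1) (s+1)^4 ≤ 2 (s+1)^9`.

## References

* C. Ikenmeyer, J. M. Landsberg, *On the complexity of the permanent in various computational
  models*, J. Pure Appl. Algebra 221 (2017), Thm. 4.1, Rem. 4.5, §2. [IkenmeyerLandsberg2017]
* P. Bürgisser, M. Clausen, M. A. Shokrollahi, *Algebraic Complexity Theory* (1997), Thm. (21.27),
  Lemma (21.28). [BurgisserClausenShokrollahi1997]
* M. Mahajan, V. Vinay, *Determinant: combinatorics, algorithms, and complexity* (1997) (layered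
  branching programs and their unipotent adjacency matrices). [MahajanVinay1997]
* L. G. Valiant, *Completeness classes in algebra* (1979). [Valiant1979]
-/

open MvPolynomial Matrix
open scoped BigOperators Matrix
open Literature.Computability.AlgebraicComplexity

-- the mandated summit-side namespace `Summit.ValiantsHypothesis.ValiantsHypothesis.…`
-- (single-problem summit: summit name = problem name) repeats a component by design
set_option linter.dupNamespace false

namespace Summit.ValiantsHypothesis.ValiantsHypothesis.Theorems.BorderApolarityFixedWitnessObstructionQP

/-! ### The layered branching program of a square matrix -/

section Layered

variable {R : Type*} [CommRing R] {n : Type*} [Fintype n] [DecidableEq n] {d : ℕ}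
  {A : Matrix n n R} {E : Matrix (Fin (d + 1) × n) (Fin (d + 1) × n) R}

/-- **Powers of the layered adjacency matrix.** If `E` is the adjacency matrix of the layered
branching program of `A` with `d + 1` layers (`E ((ℓ, a), (ℓ', b)) = A a b` if `ℓ' = ℓ + 1`, else
`0`), then `E^m ((ℓ, a), (ℓ', b)) = (A^m) a b` if `ℓ' = ℓ + m` and `0` otherwise: paths of length
`m` climb exactly `m` layers and multiply `m` entries of `A` (Ikenmeyer–Landsberg 2017, §2 and
Rem. 4.5: iterated matrix multiplication as a layered branching program). [folklore] -/
theorem layered_pow_apply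
    (hE : ∀ p q, E p q = if (q.1 : ℕ) = p.1 + 1 then A p.2 q.2 else 0) (m : ℕ)
    (p q : Fin (d + 1) × n) :
    (E ^ m) p q = if (q.1 : ℕ) = p.1 + m then (A ^ m) p.2 q.2 else 0 := by
  induction m generalizing p q with
  | zero =>
    rw [pow_zero, pow_zero, add_zero, Matrix.one_apply, Matrix.one_apply]
    by_cases hpq : p = q
    · subst hpq
      simp
    · rw [if_neg hpq]
      by_cases h1 : (q.1 : ℕ) = p.1
      · have h2 : ¬p.2 = q.2 := fun h2 => hpq (Prod.ext (Fin.ext h1.symm) h2)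
        rw [if_pos h1, if_neg h2]
      · rw [if_neg h1]
  | succ m ih =>
    rw [pow_succ, pow_succ, Matrix.mul_apply, Fintype.sum_prod_type]
    simp only [ih, hE]
    by_cases h : (q.1 : ℕ) = p.1 + (m + 1)
    · -- the unique intermediate layer `p.1 + m`
      have hlt : (p.1 : ℕ) + m < d + 1 := by have := q.1.isLt; omega
      rw [if_pos h, Finset.sum_eq_single (⟨p.1 + m, hlt⟩ : Fin (d + 1))]
      · have hq : (q.1 : ℕ) = (p.1 : ℕ) + m + 1 := by omega
        simp only [hq, if_true, Matrix.mul_apply]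
      · intro b _ hb
        have hb' : ¬((b : ℕ) = p.1 + m) := fun h' => hb (Fin.ext h')
        simp only [hb', if_false, zero_mul, Finset.sum_const_zero]
      · intro hb
        exact absurd (Finset.mem_univ _) hb
    · rw [if_neg h]
      refine Finset.sum_eq_zero fun b _ => Finset.sum_eq_zero fun c _ => ?_
      by_cases h1 : (b : ℕ) = p.1 + m
      · have h2 : ¬((q.1 : ℕ) = b + 1) := fun h2 => h (by omega)
        rw [if_neg h2, mul_zero]
      · rw [if_neg h1, zero_mul]

/-- The layered adjacency matrix with `d + 1` layers is nilpotent of order `d + 1` (no path climbs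
`d + 1` layers). [folklore] -/
theorem layered_pow_eq_zero
    (hE : ∀ p q, E p q = if (q.1 : ℕ) = p.1 + 1 then A p.2 q.2 else 0) :
    E ^ (d + 1) = 0 := by
  ext p q
  rw [layered_pow_apply hE, Matrix.zero_apply, if_neg]
  have := q.1.isLt
  omega

/-- The inverse of `1 - E` for the layered adjacency matrix `E` is the finite geometric series
`∑_{m ≤ d} E^m` (sum over paths of all lengths). [folklore] -/
theorem layered_inv
    (hE : ∀ p q, E p q = if (q.1 : ℕ) = p.1 + 1 then A p.2 q.2 else 0) :
    (1 - E)⁻¹ = ∑ m ∈ Finset.range (d + 1), E ^ m :=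
  Matrix.inv_eq_right_inv (by rw [mul_neg_geom_sum, layered_pow_eq_zero hE, sub_zero])

/-- Source-to-sink read-out: the `((0, i), (d, j))` entry of `(1 - E)⁻¹` is `(A^d) i j`
(Ikenmeyer–Landsberg 2017, Rem. 4.5). [folklore] -/
theorem layered_inv_apply
    (hE : ∀ p q, E p q = if (q.1 : ℕ) = p.1 + 1 then A p.2 q.2 else 0) (i j : n) :
    (1 - E)⁻¹ ((0 : Fin (d + 1)), i) (Fin.last d, j) = (A ^ d) i j := by
  rw [layered_inv hE, Matrix.sum_apply, Finset.sum_eq_single d]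
  · rw [layered_pow_apply hE, if_pos]
    simp
  · intro m _ hm
    rw [layered_pow_apply hE, if_neg]
    simp only [Fin.val_last, Fin.val_zero, zero_add]
    exact fun h => hm h.symm
  · intro hd
    exact absurd (Finset.mem_range.mpr (Nat.lt_succ_self d)) hd

/-- The layered matrix `1 - E` is block upper triangular for the layer map with identity diagonal
blocks, hence unipotent: `det (1 - E) = 1` (Mahajan–Vinay 1997; Ikenmeyer–Landsberg 2017, §2).
[folklore] -/
theorem layered_det
    (hE : ∀ p q, E p q = if (q.1 : ℕ) = p.1 + 1 then A p.2 q.2 else 0) :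
    (1 - E).det = 1 := by
  have hbt : (1 - E).BlockTriangular Prod.fst := by
    intro p q hpq
    have hlt : (q.1 : ℕ) < p.1 := hpq
    have h1 : ¬p = q := fun h => by subst h; exact lt_irrefl _ hlt
    have h2 : ¬((q.1 : ℕ) = p.1 + 1) := by omega
    rw [Matrix.sub_apply, Matrix.one_apply, hE, if_neg h1, if_neg h2, sub_zero]
  rw [hbt.det_fintype]
  refine Finset.prod_eq_one fun a _ => ?_
  have hblock : (1 - E).toSquareBlock Prod.fst a = 1 := by
    ext p q
    have h2 : ¬(((q : Fin (d + 1) × n).1 : ℕ) = (p : Fin (d + 1) × n).1 + 1) := by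
      rw [q.2, p.2]; omega
    rw [toSquareBlock_def, Matrix.of_apply, Matrix.sub_apply, Matrix.one_apply, Matrix.one_apply,
      hE, if_neg h2, sub_zero]
    simp only [Subtype.ext_iff]
  rw [hblock, Matrix.det_one]

end Layered

/-! ### Inverse read-outs of entries of matrix powers -/

section InvRepr

variable {k : Type*} [CommRing k] {σ : Type*}

/-- Constant indicator vectors pass through `C`. [folklore] -/
theorem C_pi_single_one {ι : Type*} [DecidableEq ι] (p₀ p : ι) :
    (C ((Pi.single p₀ 1 : ι → k) p) : MvPolynomial σ k) =
      (Pi.single p₀ 1 : ι → MvPolynomial σ k) p := by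
  by_cases hp : p = p₀
  · subst hp
    simp
  · simp [Pi.single_eq_of_ne hp]

/-- **The layered branching program lemma.** If `A` is a square matrix of affine linear forms on
a finite index type `n`, then every entry of `A^d` is an inverse read-out of size `(d+1) · #n`:
with `E` the layered adjacency matrix of `A` on `Fin (d+1) × n`, the matrix `B = 1 - E` has affine
entries and `det B = 1` (`layered_det`), and `(B⁻¹) ((0, i), (d, j)) = (A^d) i j`
(`layered_inv_apply`), read out by the constant indicator vectors of `(0, i)` and `(d, j)`
(Ikenmeyer–Landsberg 2017, §2 and Rem. 4.5; the size bookkeeping `HasInvRepr` of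
Bürgisser–Clausen–Shokrollahi 1997, Thm. (21.27)). [folklore] -/
theorem hasInvRepr_pow_apply {n : Type} [Fintype n] [DecidableEq n]
    (A : Matrix n n (MvPolynomial σ k)) (hA : ∀ i j, (A i j).totalDegree ≤ 1) (d : ℕ) (i j : n) :
    HasInvRepr ((A ^ d) i j) ((d + 1) * Fintype.card n) := by
  -- the layered adjacency matrix
  let E : Matrix (Fin (d + 1) × n) (Fin (d + 1) × n) (MvPolynomial σ k) :=
    Matrix.of fun p q => if (q.1 : ℕ) = p.1 + 1 then A p.2 q.2 else 0
  have hE : ∀ p q, E p q = if (q.1 : ℕ) = p.1 + 1 then A p.2 q.2 else 0 := fun p q => rfl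
  refine ⟨Fin (d + 1) × n, inferInstance, inferInstance, 1 - E, Pi.single ((0 : Fin (d + 1)), i) 1,
    Pi.single (Fin.last d, j) 1, ?_, ?_, layered_det hE, ?_⟩
  · rw [Fintype.card_prod, Fintype.card_fin]
  · intro p q
    rw [Matrix.sub_apply]
    refine (totalDegree_sub _ _).trans (max_le ?_ ?_)
    · rw [Matrix.one_apply]
      split_ifs
      · exact totalDegree_one.le.trans zero_le_one
      · exact totalDegree_zero.le.trans zero_le_one
    · rw [hE]
      split_ifs
      · exact hA _ _
      · exact totalDegree_zero.le.trans zero_le_one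
  · have hv : (fun p => C ((Pi.single ((0 : Fin (d + 1)), i) 1 : Fin (d + 1) × n → k) p)) =
        (Pi.single ((0 : Fin (d + 1)), i) 1 : Fin (d + 1) × n → MvPolynomial σ k) :=
      funext (C_pi_single_one _)
    have hw : (fun p => C ((Pi.single (Fin.last d, j) 1 : Fin (d + 1) × n → k) p)) =
        (Pi.single (Fin.last d, j) 1 : Fin (d + 1) × n → MvPolynomial σ k) :=
      funext (C_pi_single_one _)
    rw [hv, hw, Matrix.mulVec_single_one, single_one_dotProduct, Matrix.col_apply,
      layered_inv_apply hE]

/-- Traces of powers: if `A` is an `N × N` matrix of affine linear forms then `tr(A^d)` is an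
inverse read-out of size `N · (d+1) · N` (sum of the `N` diagonal read-outs,
`HasInvRepr.finset_sum`; Bürgisser–Clausen–Shokrollahi 1997, Lemma (21.28)). [folklore] -/
theorem hasInvRepr_trace_pow {N : ℕ} (A : Matrix (Fin N) (Fin N) (MvPolynomial σ k))
    (hA : ∀ i j, (A i j).totalDegree ≤ 1) (d : ℕ) :
    HasInvRepr ((A ^ d).trace) (N * ((d + 1) * N)) := by
  have hsum := HasInvRepr.finset_sum (Finset.univ : Finset (Fin N))
    (fun i _ => hasInvRepr_pow_apply A hA d i i)
  rwa [Finset.card_univ, Fintype.card_fin] at hsum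

end InvRepr

/-! ### The stub -/

/-- The size bound: `N + 1 ≤ (d+1)((s³-s)/3 + 2)` and `d ≤ s` give `N (d+1) N ≤ 2 (s+1)^9`
(indeed `≤ (s+1)^9`, via `(s³-s)/3 + 2 ≤ (s+1)^3` for `s ≥ 1`). [folklore] -/
theorem invRepr_size_bound {N d s : ℕ} (hN : N + 1 ≤ (d + 1) * ((s ^ 3 - s) / 3 + 2))
    (hds : d ≤ s) (hs : 1 ≤ s) : N * ((d + 1) * N) ≤ 2 * (s + 1) ^ 9 := by
  have hφ : (s ^ 3 - s) / 3 + 2 ≤ (s + 1) ^ 3 := by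
    have h1 : (s ^ 3 - s) / 3 ≤ s ^ 3 := (Nat.div_le_self _ _).trans (Nat.sub_le _ _)
    have h2 : (s + 1) ^ 3 = s ^ 3 + 3 * s ^ 2 + 3 * s + 1 := by ring
    rw [h2]
    omega
  have hN1 : N ≤ (s + 1) ^ 4 := by
    have h := hN.trans (Nat.mul_le_mul (by omega : d + 1 ≤ s + 1) hφ)
    have h4 : (s + 1) * (s + 1) ^ 3 = (s + 1) ^ 4 := by ring
    omega
  calc N * ((d + 1) * N) ≤ (s + 1) ^ 4 * ((s + 1) * (s + 1) ^ 4) :=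
        Nat.mul_le_mul hN1 (Nat.mul_le_mul (by omega : d + 1 ≤ s + 1) hN1)
    _ = (s + 1) ^ 9 := by ring
    _ ≤ 2 * (s + 1) ^ 9 := Nat.le_mul_of_pos_left _ Nat.zero_lt_two

/-- **From determinantal expressions to inverse read-outs, polynomially.** A homogeneous `f` of
degree `d` over `ℂ` with an affine determinantal expression of size `s` is a constant bilinear
read-out `vᵀ B⁻¹ w` of an affine matrix `B` with `det B = 1` of size `≤ 2 (s+1)^9`. Affine `f`:
the `2 × 2` matrix (Bürgisser–Clausen–Shokrollahi 1997, Thm. (21.27), Case 1); otherwise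
`f = tr(A^d)` for an `N × N` matrix of linear forms with `N + 1 ≤ (d+1)((s³-s)/3+2)`
(Ikenmeyer–Landsberg 2017, Thm. 4.1 with Rem. 4.5, PROVED in the tree as
`IkenmeyerLandsberg2017_powTrace_of_detRepr_holds`), the layered branching program of `A`
(`hasInvRepr_trace_pow`), and `N (d+1) N ≤ 2 (s+1)^9` (`invRepr_size_bound`, using
`d = deg f ≤ s`).
[cite: IkenmeyerLandsberg2017, Thm. 4.1 and Rem. 4.5] -/
theorem stub_invReprOfDetRepr :
    ∀ (σ : Type) [Fintype σ] [DecidableEq σ] (f : MvPolynomial σ ℂ) (d s : ℕ),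
      f.IsHomogeneous d → HasDetRepr f s → HasInvRepr f (2 * (s + 1) ^ 9) := by
  intro σ _ _ f d s hf hdet
  have h9 : 1 ≤ (s + 1) ^ 9 := Nat.one_le_pow _ _ (Nat.succ_pos s)
  -- affine `f` (in particular `f = 0` and `d ≤ 1`): a `2 × 2` matrix
  by_cases h1 : f.totalDegree ≤ 1
  · exact (HasInvRepr.of_totalDegree_le_one h1).mono (by omega)
  -- otherwise `2 ≤ d = deg f ≤ s`
  have hf0 : f ≠ 0 := by
    rintro rfl
    exact h1 (totalDegree_zero.le.trans zero_le_one)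
  have hfd : f.totalDegree = d := hf.totalDegree hf0
  have hds : d ≤ s := hfd ▸ totalDegree_le_of_hasDetRepr_holds hdet
  have hd : 1 ≤ d := by omega
  obtain ⟨N, A, hN, hA, htr⟩ := IkenmeyerLandsberg2017_powTrace_of_detRepr_holds f d s hd hf hdet
  have hA1 : ∀ i j, (A i j).totalDegree ≤ 1 := fun i j => (hA i j).totalDegree_le
  rw [← htr]
  exact (hasInvRepr_trace_pow A hA1 d).mono (invRepr_size_bound hN hds (hd.trans hds))

end Summit.ValiantsHypothesis.ValiantsHypothesis.Theorems.BorderApolarityFixedWitnessObstructionQP
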